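import Mathlib
import Summits.Schanuel.Schanuel.Theorems.RigidCoreSparsityTwoDefs
import Literature.NumberTheory.Transcendental.PiTranscendenceMeasureMain

/-!
# π-monomial wild jets carry a finite DEPTH CAP (pocket `stub_wildPiMonomialDepthCapRay`, lead c4)

Pocket of the line `cusp-germ-schneider-sparsity` for the crux `RigidCore.SparsityTwo` (item
stmt-Schanuel-0971), atom A3 (`WildCuspAtom`): integer hits `A(w n) + g (w n)⁻¹ ∈ ℤ` on the ray
`w n = n^{1/e}` (`rayAbscissa e n`).  For a π-MONOMIAL jet `A(w) = q (2π)^{j/e} w^m + q₀`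
(`q, q₀ ∈ ℚ`, `q ≠ 0`, `j ≠ 0`) there is `K = K(e, m, j)` such that every tail `g` analytic at `0`
and flat to order `K` has finitely many hits.  Mechanism: with `θ = (2π)^{j/e}`, `w = n^{1/e}`,
`σ = w⁻¹` and cleared denominators (`N q = a`, `N q₀ = c`), a hit gives `a θ w^m = Z + ε`, `Z ∈ ℤ`,
`ε = −N g σ`, `|ε| ≤ B w^{−(K+1)}`; raising to the `e`-th power (`w^e = n`, `θ^e = (2π)^{±d}`,
`d = |j|`) yields a NON-ZERO INTEGER POLYNOMIAL `u X^d − v` of length `≤ C₂ n^m + 3` with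
`|u π^d − v| ≤ (2π)^d |(Z+ε)ᵉ − Zᵉ| ≤ (2π)^d e (C₁ w^m)^{e−1} |ε|`, against the
NESTERENKO–WALDSCHMIDT transcendence measure of `π` (PROVED in the tree:
`NesterenkoWaldschmidt1996_thm_2_2_holds`), `|P(π)| ≥ exp(−2·10⁶ d (log L + d log d)(1 + log d))
≥ c_d L^{−⌈κ_d⌉}`; for `K = m(e−1) + e m ⌈κ_d⌉` this forces `w ≤ R`, i.e. `n ≤ Rᵉ`.
No unproved facts; axioms standard.
-/

set_option linter.dupNamespace false

namespace Summit.Schanuel.Schanuel.Cruxes.SparsityTwo.CuspGermSchneiderSparsity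

open Filter Topology Complex Polynomial Literature.NumberTheory.Transcendental
open scoped Real

/-- Binomial increment bound: `|(x + y)^{k+1} − x^{k+1}| ≤ (k + 1) (|x| + |y|)^k |y|`. [folklore] -/
theorem wildPi_abs_add_pow_succ_sub_le (x y : ℝ) (k : ℕ) :
    |(x + y) ^ (k + 1) - x ^ (k + 1)| ≤ (k + 1) * (|x| + |y|) ^ k * |y| := by
  induction k with
  | zero => simp
  | succ k ih =>
    have h : (x + y) ^ (k + 1 + 1) - x ^ (k + 1 + 1) =
        (x + y) * ((x + y) ^ (k + 1) - x ^ (k + 1)) + y * x ^ (k + 1) := by ring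
    rw [h]
    have hs : |x| ≤ |x| + |y| := le_add_of_nonneg_right (abs_nonneg y)
    calc |(x + y) * ((x + y) ^ (k + 1) - x ^ (k + 1)) + y * x ^ (k + 1)|
        ≤ |(x + y) * ((x + y) ^ (k + 1) - x ^ (k + 1))| + |y * x ^ (k + 1)| := abs_add_le _ _
      _ = |x + y| * |(x + y) ^ (k + 1) - x ^ (k + 1)| + |y| * |x| ^ (k + 1) := by
          rw [abs_mul, abs_mul, abs_pow]
      _ ≤ (|x| + |y|) * ((k + 1) * (|x| + |y|) ^ k * |y|) + |y| * (|x| + |y|) ^ (k + 1) :=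
          add_le_add (mul_le_mul (abs_add_le x y) ih (abs_nonneg _) (by positivity))
            (mul_le_mul_of_nonneg_left (pow_le_pow_left₀ (abs_nonneg x) hs _) (abs_nonneg y))
      _ = ((↑(k + 1) : ℝ) + 1) * (|x| + |y|) ^ (k + 1) * |y| := by push_cast; ring

/-- Binomial increment bound: `|(x + y)^k − x^k| ≤ k (|x| + |y|)^{k−1} |y|`. [folklore] -/
theorem wildPi_abs_add_pow_sub_pow_le (x y : ℝ) (k : ℕ) :
    |(x + y) ^ k - x ^ k| ≤ k * (|x| + |y|) ^ (k - 1) * |y| := by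
  rcases k with _ | k
  · simp
  · simpa using wildPi_abs_add_pow_succ_sub_le x y k

/-- NESTERENKO–WALDSCHMIDT for the two-term polynomial `u X^d − v` (`d ≥ 1`, `(u, v) ≠ 0`, length
`|u| + |v| ≤ L`, `L ≥ 3`): `exp(−2·10⁶ d (log L + d log d)(1 + log d)) ≤ |u π^d − v|`; from the tree
theorem `NesterenkoWaldschmidt1996_thm_2_2_holds`. -/
theorem wildPi_nw_two_term {d : ℕ} (hd : 1 ≤ d) (u v : ℤ) (huv : u ≠ 0 ∨ v ≠ 0) (L : ℕ)
    (hL : |u| + |v| ≤ (L : ℤ)) (hL3 : 3 ≤ L) :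
    Real.exp (-(2 * 10 ^ 6 * (d : ℝ) * (Real.log L + d * Real.log d) * (1 + Real.log d))) ≤
      |(u : ℝ) * π ^ d - v| := by
  classical
  set P : ℤ[X] := C u * X ^ d - C v with hP
  have hd0 : d ≠ 0 := by omega
  have hcoeff : ∀ k, P.coeff k = (if k = d then u else 0) - (if k = 0 then v else 0) := by
    intro k
    rw [hP, coeff_sub, coeff_C_mul_X_pow, coeff_C]
  have hP0 : P ≠ 0 := by
    intro h0
    rcases huv with hu | hv
    · have h := hcoeff d
      rw [h0, coeff_zero, if_pos rfl, if_neg hd0, sub_zero] at h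
      exact hu h.symm
    · have h := hcoeff 0
      rw [h0, coeff_zero, if_neg (Ne.symm hd0), if_pos rfl, zero_sub, zero_eq_neg] at h
      exact hv h
  have hdeg : P.natDegree ≤ d := by
    rw [hP]
    exact (natDegree_sub_le _ _).trans (max_le (natDegree_C_mul_X_pow_le _ _) (by simp))
  have hlen : (∑ k ∈ Finset.range (P.natDegree + 1), |P.coeff k|) ≤ (L : ℤ) := by
    have hck : ∀ k, |P.coeff k| ≤ (if k = d then |u| else 0) + (if k = 0 then |v| else 0) := by
      intro k
      rw [hcoeff k]
      refine (abs_sub _ _).trans (le_of_eq ?_)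
      split_ifs <;> simp
    calc (∑ k ∈ Finset.range (P.natDegree + 1), |P.coeff k|)
        ≤ ∑ k ∈ Finset.range (P.natDegree + 1),
            ((if k = d then |u| else 0) + (if k = 0 then |v| else 0)) :=
          Finset.sum_le_sum fun k _ => hck k
      _ = (∑ k ∈ Finset.range (P.natDegree + 1), (if k = d then |u| else 0)) +
            ∑ k ∈ Finset.range (P.natDegree + 1), (if k = 0 then |v| else 0) :=
          Finset.sum_add_distrib
      _ ≤ |u| + |v| := by
          rw [Finset.sum_ite_eq', Finset.sum_ite_eq']
          split_ifs <;> linarith [abs_nonneg u, abs_nonneg v]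
      _ ≤ L := hL
  have hval : ‖aeval (π : ℂ) P‖ = |(u : ℝ) * π ^ d - v| := by
    have h1 : aeval (π : ℂ) P = (((u : ℝ) * π ^ d - v : ℝ) : ℂ) := by
      simp only [hP, map_sub, map_mul, map_pow, aeval_X, eq_intCast, map_intCast]
      push_cast
      ring
    rw [h1, Complex.norm_real, Real.norm_eq_abs]
  have h := NesterenkoWaldschmidt1996_thm_2_2_holds P d L hP0 hd hdeg hlen hL3
  rwa [hval] at h

/-- The NW exponent splits as `−κ_d log L − κ_d d log d` (`κ_d = 2·10⁶ d (1 + log d)`), so for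
`L ≥ 1` and `κ_d ≤ k₀` the NW bound dominates `c_d · L^{−k₀}`, `c_d = exp(−κ_d d log d)`. -/
theorem wildPi_nw_exp_lower {d k₀ L : ℕ} (hk₀ : 2 * 10 ^ 6 * (d : ℝ) * (1 + Real.log d) ≤ k₀)
    (hL : 1 ≤ L) :
    Real.exp (-(2 * 10 ^ 6 * (d : ℝ) * (d * Real.log d) * (1 + Real.log d))) * ((L : ℝ) ^ k₀)⁻¹ ≤
      Real.exp (-(2 * 10 ^ 6 * (d : ℝ) * (Real.log L + d * Real.log d) * (1 + Real.log d))) := by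
  have hL0 : (0 : ℝ) < L := by exact_mod_cast hL
  have hL1 : (1 : ℝ) ≤ L := by exact_mod_cast hL
  have hsplit : -(2 * 10 ^ 6 * (d : ℝ) * (Real.log L + d * Real.log d) * (1 + Real.log d)) =
      -(2 * 10 ^ 6 * (d : ℝ) * (d * Real.log d) * (1 + Real.log d)) +
        Real.log L * (-(2 * 10 ^ 6 * (d : ℝ) * (1 + Real.log d))) := by
    ring
  rw [hsplit, Real.exp_add, ← Real.rpow_def_of_pos hL0]
  gcongr
  rw [← Real.rpow_natCast (L : ℝ) k₀, ← Real.rpow_neg hL0.le]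
  exact Real.rpow_le_rpow_of_exponent_le hL1 (neg_le_neg hk₀)

/-- Elementary arithmetic of the final comparison (natural powers only): from
`c₀ w^{K+1} ≤ A w^{m(e−1)} Lₙ^{k₀}`, `Lₙ ≤ C₃ w^{em}` and `K = m(e−1) + e m k₀` get
`w ≤ A C₃^{k₀} / c₀`. -/
theorem wildPi_arith {e m k₀ K : ℕ} {w c₀ A C₃ Ln : ℝ} (hK : K = m * (e - 1) + e * m * k₀)
    (hw : 0 < w) (hc₀ : 0 < c₀) (hA : 0 ≤ A) (hLn : 0 ≤ Ln)
    (h1 : c₀ * w ^ (K + 1) ≤ A * w ^ (m * (e - 1)) * Ln ^ k₀)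
    (h2 : Ln ≤ C₃ * w ^ (e * m)) :
    w ≤ A * C₃ ^ k₀ / c₀ := by
  subst hK
  have h3 : Ln ^ k₀ ≤ C₃ ^ k₀ * w ^ (e * m * k₀) := by
    calc Ln ^ k₀ ≤ (C₃ * w ^ (e * m)) ^ k₀ := pow_le_pow_left₀ hLn h2 _
      _ = C₃ ^ k₀ * w ^ (e * m * k₀) := by rw [mul_pow, ← pow_mul]
  have h4 : c₀ * w * (w ^ (m * (e - 1)) * w ^ (e * m * k₀)) ≤
      A * C₃ ^ k₀ * (w ^ (m * (e - 1)) * w ^ (e * m * k₀)) := by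
    calc c₀ * w * (w ^ (m * (e - 1)) * w ^ (e * m * k₀))
        = c₀ * w ^ (m * (e - 1) + e * m * k₀ + 1) := by ring
      _ ≤ A * w ^ (m * (e - 1)) * Ln ^ k₀ := h1
      _ ≤ A * w ^ (m * (e - 1)) * (C₃ ^ k₀ * w ^ (e * m * k₀)) :=
          mul_le_mul_of_nonneg_left h3 (by positivity)
      _ = A * C₃ ^ k₀ * (w ^ (m * (e - 1)) * w ^ (e * m * k₀)) := by ring
  have h5 : c₀ * w ≤ A * C₃ ^ k₀ := le_of_mul_le_mul_right h4 (by positivity)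
  rw [le_div_iff₀ hc₀, mul_comm]
  exact h5

/-- **The per-hit bound.**  Fix `e ≥ 1`, `d ≥ 1`, `κ_d ≤ k₀`, `K = m(e−1) + e m k₀`, `a ∈ ℤ ∖ {0}`,
`Θ > 0` with `Θ^e = (2π)^d` or `Θ^e (2π)^d = 1`, and `B ≥ 0`.  There is `R` such that whenever
`w ≥ 1`, `w^e = n ≥ 1`, `a Θ w^m = Z + ε` (`Z ∈ ℤ`) with `|ε| ≤ B` and `|ε| w^{K+1} ≤ B`, then
`w ≤ R`: the integer polynomial `u X^d − v` built from `(a Θ w^m)^e = (Z + ε)^e` has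
`|u π^d − v| ≤ (2π)^d e (C₁ w^m)^{e−1} |ε|` against the NW lower bound `c_d (C₂ n^m + 3)^{−k₀}`. -/
theorem wildPi_hit_bound {e m d k₀ K : ℕ} (he : 0 < e) (hd : 1 ≤ d)
    (hk₀ : 2 * 10 ^ 6 * (d : ℝ) * (1 + Real.log d) ≤ k₀) (hK : K = m * (e - 1) + e * m * k₀)
    {a : ℤ} (ha : a ≠ 0) {Θ B : ℝ} (hΘ : 0 < Θ)
    (hΘe : Θ ^ e = (2 * π) ^ d ∨ Θ ^ e * (2 * π) ^ d = 1) (hB : 0 ≤ B) :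
    ∃ R : ℝ, ∀ (n : ℕ) (w : ℝ) (Z : ℤ) (ε : ℝ), 1 ≤ n → 1 ≤ w → w ^ e = n →
      (a : ℝ) * Θ * w ^ m = Z + ε → |ε| ≤ B → |ε| * w ^ (K + 1) ≤ B → w ≤ R := by
  -- the constants
  have ha' : 0 < |(a : ℝ)| := abs_pos.mpr (by exact_mod_cast ha)
  obtain ⟨C₁, hC₁⟩ : ∃ C₁ : ℝ, C₁ = |(a : ℝ)| * Θ + 2 * B := ⟨_, rfl⟩
  have hC₁0 : 0 < C₁ := by rw [hC₁]; positivity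
  obtain ⟨C₂, hC₂⟩ : ∃ C₂ : ℕ, C₂ = ⌈(|(a : ℝ)| ^ e + C₁ ^ e) * 2 ^ d⌉₊ := ⟨_, rfl⟩
  have hC₂' : (|(a : ℝ)| ^ e + C₁ ^ e) * 2 ^ d ≤ C₂ := by rw [hC₂]; exact Nat.le_ceil _
  obtain ⟨c₀, hc₀⟩ : ∃ c₀ : ℝ,
      c₀ = Real.exp (-(2 * 10 ^ 6 * (d : ℝ) * (d * Real.log d) * (1 + Real.log d))) := ⟨_, rfl⟩
  have hc₀0 : 0 < c₀ := by rw [hc₀]; exact Real.exp_pos _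
  obtain ⟨A, hA⟩ : ∃ A : ℝ, A = (2 * π) ^ d * e * C₁ ^ (e - 1) * B := ⟨_, rfl⟩
  have hA0 : 0 ≤ A := by rw [hA]; positivity
  refine ⟨A * ((C₂ : ℝ) + 3) ^ k₀ / c₀, ?_⟩
  intro n w Z ε hn hw hwe hX hεB hεw
  have hw0 : 0 < w := by linarith
  have hn' : (n : ℝ) ^ m = w ^ (e * m) := by rw [← hwe, ← pow_mul]
  have hwm : 1 ≤ w ^ m := one_le_pow₀ hw
  have hnm0 : (0 : ℝ) ≤ (n : ℝ) ^ m := by positivity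
  have h2π1 : (1 : ℝ) ≤ (2 * π) ^ d := one_le_pow₀ (by linarith [Real.pi_gt_three])
  have h2d : (1 : ℝ) ≤ 2 ^ d := one_le_pow₀ (by norm_num)
  -- `|Z| + |ε| ≤ C₁ w^m`
  have hZε : |(Z : ℝ)| + |ε| ≤ C₁ * w ^ m := by
    have h1 : |(Z : ℝ)| ≤ |(a : ℝ)| * Θ * w ^ m + |ε| := by
      rw [show (Z : ℝ) = a * Θ * w ^ m - ε by linarith]
      refine (abs_sub _ _).trans_eq ?_
      rw [abs_mul, abs_mul, abs_of_pos hΘ, abs_of_pos (pow_pos hw0 m)]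
    have h3 : 2 * B * 1 ≤ 2 * B * w ^ m := mul_le_mul_of_nonneg_left hwm (by positivity)
    calc |(Z : ℝ)| + |ε| ≤ |(a : ℝ)| * Θ * w ^ m + 2 * B * w ^ m := by linarith
      _ = C₁ * w ^ m := by rw [hC₁]; ring
  have hZ : |(Z : ℝ)| ≤ C₁ * w ^ m := le_trans (le_add_of_nonneg_right (abs_nonneg ε)) hZε
  have hZe : |(Z : ℝ)| ^ e ≤ C₁ ^ e * (n : ℝ) ^ m := by
    calc |(Z : ℝ)| ^ e ≤ (C₁ * w ^ m) ^ e := pow_le_pow_left₀ (abs_nonneg _) hZ e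
      _ = C₁ ^ e * (n : ℝ) ^ m := by rw [mul_pow, ← pow_mul, hn', mul_comm m e]
  -- `|(Z+ε)^e − Z^e| ≤ e (C₁ w^m)^(e-1) |ε|`
  have hE : |((Z : ℝ) + ε) ^ e - (Z : ℝ) ^ e| ≤ e * (C₁ * w ^ m) ^ (e - 1) * |ε| := by
    calc |((Z : ℝ) + ε) ^ e - (Z : ℝ) ^ e| ≤ e * (|(Z : ℝ)| + |ε|) ^ (e - 1) * |ε| :=
          wildPi_abs_add_pow_sub_pow_le _ _ _
      _ ≤ e * (C₁ * w ^ m) ^ (e - 1) * |ε| := by gcongr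
  -- the length `Lₙ = C₂ n^m + 3`
  obtain ⟨Ln, hLn⟩ : ∃ Ln : ℕ, Ln = C₂ * n ^ m + 3 := ⟨_, rfl⟩
  have hLn3 : 3 ≤ Ln := by omega
  have hLn1 : 1 ≤ Ln := by omega
  have hLn0 : (0 : ℝ) < Ln := by exact_mod_cast (show 0 < Ln by omega)
  have hLnR : (|(a : ℝ)| ^ e + C₁ ^ e) * 2 ^ d * (n : ℝ) ^ m ≤ (Ln : ℝ) := by
    rw [hLn]
    push_cast
    calc (|(a : ℝ)| ^ e + C₁ ^ e) * 2 ^ d * (n : ℝ) ^ m ≤ (C₂ : ℝ) * (n : ℝ) ^ m :=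
          mul_le_mul_of_nonneg_right hC₂' hnm0
      _ ≤ (C₂ : ℝ) * (n : ℝ) ^ m + 3 := by linarith
  have hmul : ∀ t : ℝ, 0 ≤ t → t * (n : ℝ) ^ m ≤ t * 2 ^ d * (n : ℝ) ^ m := fun t ht => by
    rw [mul_assoc]
    exact mul_le_mul_of_nonneg_left (le_mul_of_one_le_left hnm0 h2d) ht
  have hXe : ((Z : ℝ) + ε) ^ e = (a : ℝ) ^ e * Θ ^ e * (n : ℝ) ^ m := by
    rw [← hX, mul_pow, mul_pow, ← pow_mul, hn', mul_comm m e]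
  have hn0 : (n : ℤ) ≠ 0 := by exact_mod_cast (show n ≠ 0 by omega)
  -- the two-term integer relation `u π^d − v`
  obtain ⟨u, v, huv, hL, hval⟩ : ∃ u v : ℤ, (u ≠ 0 ∨ v ≠ 0) ∧ |u| + |v| ≤ (Ln : ℤ) ∧
      |(u : ℝ) * π ^ d - v| ≤ (2 * π) ^ d * |((Z : ℝ) + ε) ^ e - (Z : ℝ) ^ e| := by
    rcases hΘe with hΘe | hΘe
    · refine ⟨a ^ e * 2 ^ d * (n : ℤ) ^ m, Z ^ e, Or.inl ?_, ?_, ?_⟩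
      · exact mul_ne_zero (mul_ne_zero (pow_ne_zero _ ha) (pow_ne_zero _ two_ne_zero))
          (pow_ne_zero _ hn0)
      · have h : (((|a ^ e * 2 ^ d * (n : ℤ) ^ m| + |Z ^ e| : ℤ)) : ℝ) ≤ ((Ln : ℤ) : ℝ) := by
          push_cast
          simp only [abs_mul, abs_pow, abs_two, Nat.abs_cast]
          linarith [hZe, hmul (C₁ ^ e) (by positivity), hLnR]
        exact_mod_cast h
      · push_cast
        have h : (a : ℝ) ^ e * 2 ^ d * (n : ℝ) ^ m * π ^ d - (Z : ℝ) ^ e =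
            ((Z : ℝ) + ε) ^ e - (Z : ℝ) ^ e := by
          rw [hXe, hΘe, mul_pow]
          ring
        rw [h]
        exact le_mul_of_one_le_left (abs_nonneg _) h2π1
    · refine ⟨Z ^ e * 2 ^ d, a ^ e * (n : ℤ) ^ m, Or.inr ?_, ?_, ?_⟩
      · exact mul_ne_zero (pow_ne_zero _ ha) (pow_ne_zero _ hn0)
      · have hZe2 : |(Z : ℝ)| ^ e * 2 ^ d ≤ C₁ ^ e * 2 ^ d * (n : ℝ) ^ m :=
          (mul_le_mul_of_nonneg_right hZe (by positivity)).trans_eq (by ring)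
        have h : (((|Z ^ e * 2 ^ d| + |a ^ e * (n : ℤ) ^ m| : ℤ)) : ℝ) ≤ ((Ln : ℤ) : ℝ) := by
          push_cast
          simp only [abs_mul, abs_pow, abs_two, Nat.abs_cast]
          linarith [hZe2, hmul (|(a : ℝ)| ^ e) (by positivity), hLnR]
        exact_mod_cast h
      · push_cast
        have h : (a : ℝ) ^ e * (n : ℝ) ^ m = (2 * π) ^ d * ((Z : ℝ) + ε) ^ e := by
          rw [hXe]
          linear_combination (-((a : ℝ) ^ e * (n : ℝ) ^ m)) * hΘe
        rw [show (Z : ℝ) ^ e * 2 ^ d * π ^ d - (a : ℝ) ^ e * (n : ℝ) ^ m =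
            -((2 * π) ^ d * (((Z : ℝ) + ε) ^ e - (Z : ℝ) ^ e)) by rw [h, mul_pow]; ring,
          abs_neg, abs_mul, abs_of_nonneg (by positivity : (0 : ℝ) ≤ (2 * π) ^ d)]
  -- NESTERENKO–WALDSCHMIDT, in the power form `c₀ Lₙ^{-k₀} ≤ |u π^d − v|`
  have hNW := wildPi_nw_two_term hd u v huv Ln hL hLn3
  have hlow := wildPi_nw_exp_lower (L := Ln) hk₀ hLn1
  rw [← hc₀] at hlow
  have hchain : c₀ * ((Ln : ℝ) ^ k₀)⁻¹ ≤
      (2 * π) ^ d * e * C₁ ^ (e - 1) * w ^ (m * (e - 1)) * |ε| :=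
    calc c₀ * ((Ln : ℝ) ^ k₀)⁻¹
        ≤ Real.exp (-(2 * 10 ^ 6 * (d : ℝ) * (Real.log Ln + d * Real.log d) *
            (1 + Real.log d))) := hlow
      _ ≤ |(u : ℝ) * π ^ d - v| := hNW
      _ ≤ (2 * π) ^ d * |((Z : ℝ) + ε) ^ e - (Z : ℝ) ^ e| := hval
      _ ≤ (2 * π) ^ d * (e * (C₁ * w ^ m) ^ (e - 1) * |ε|) := by gcongr
      _ = (2 * π) ^ d * e * C₁ ^ (e - 1) * w ^ (m * (e - 1)) * |ε| := by
          rw [mul_pow C₁ (w ^ m) (e - 1), ← pow_mul]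
          ring
  have h6 : c₀ ≤ (2 * π) ^ d * e * C₁ ^ (e - 1) * w ^ (m * (e - 1)) * |ε| * (Ln : ℝ) ^ k₀ :=
    (mul_inv_le_iff₀ (pow_pos hLn0 k₀)).mp hchain
  have h1 : c₀ * w ^ (K + 1) ≤ A * w ^ (m * (e - 1)) * (Ln : ℝ) ^ k₀ :=
    calc c₀ * w ^ (K + 1)
        ≤ (2 * π) ^ d * e * C₁ ^ (e - 1) * w ^ (m * (e - 1)) * |ε| * (Ln : ℝ) ^ k₀ *
            w ^ (K + 1) := mul_le_mul_of_nonneg_right h6 (by positivity)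
      _ = (2 * π) ^ d * e * C₁ ^ (e - 1) * w ^ (m * (e - 1)) * (Ln : ℝ) ^ k₀ *
            (|ε| * w ^ (K + 1)) := by ring
      _ ≤ (2 * π) ^ d * e * C₁ ^ (e - 1) * w ^ (m * (e - 1)) * (Ln : ℝ) ^ k₀ * B :=
          mul_le_mul_of_nonneg_left hεw (by positivity)
      _ = A * w ^ (m * (e - 1)) * (Ln : ℝ) ^ k₀ := by rw [hA]; ring
  have h2 : (Ln : ℝ) ≤ ((C₂ : ℝ) + 3) * w ^ (e * m) := by
    rw [hLn, ← hn']
    push_cast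
    have hn1 : (1 : ℝ) ≤ (n : ℝ) ^ m := one_le_pow₀ (by exact_mod_cast hn)
    nlinarith [hn1, (Nat.cast_nonneg C₂ : (0 : ℝ) ≤ C₂)]
  exact wildPi_arith hK hw0 hc₀0 hA0 (Nat.cast_nonneg Ln) h1 h2

/-- **stub_wildPiMonomialDepthCapRay** (POCKET "π-monomial depth cap" of the WILD cusp, atom A3;
registered stub of line `cusp-germ-schneider-sparsity`, lead c4).  For `e ≥ 1`, `m ≥ 1`, `j ≠ 0` and
rationals `q ≠ 0`, `q₀` there is `K : ℕ` such that every `g` analytic at `0` with `g⁽ⁱ⁾(0) = 0`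
(`i ≤ K`) has only finitely many `n` with `q (2π)^{j/e} (w n)^m + q₀ + g (w n)⁻¹ ∈ ℤ`,
`w n = n^{1/e}`.
Proof: `K = m(e−1) + e m ⌈κ_d⌉`, `d = |j|`; Taylor (`AnalyticAt.exists_eq_sum_add_pow_mul`) gives
`g z = z^{K+1} F z`, `‖F‖ ≤ ‖F 0‖ + 1` near `0`; a late hit yields the data of `wildPi_hit_bound`
(denominators cleared, `θ^e = (2π)^{±d}`, `w^e = n`), whence `w ≤ R`, `n ≤ Rᵉ`. -/
theorem stub_wildPiMonomialDepthCapRay :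
    ∀ (e m : ℕ) (j : ℤ) (q q₀ : ℚ), 0 < e → 0 < m → q ≠ 0 → j ≠ 0 →
      ∃ K : ℕ, ∀ g : ℂ → ℂ, AnalyticAt ℂ g 0 →
        (∀ i : ℕ, i ≤ K → iteratedDeriv i g 0 = 0) →
        Set.Finite {n : ℕ | ∃ L : ℤ,
          (q : ℂ) * (((2 * Real.pi) ^ ((j : ℝ) / (e : ℝ)) : ℝ) : ℂ) * (rayAbscissa e n) ^ m
            + (q₀ : ℂ) + g (rayAbscissa e n)⁻¹ = L} := by
  intro e m j q q₀ he _hm hq hj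
  classical
  -- `d = |j| ≥ 1`, `k₀ = ⌈κ_d⌉`, the depth cap `K = m(e-1) + e m k₀`
  obtain ⟨d, hd⟩ : ∃ d : ℕ, d = j.natAbs := ⟨_, rfl⟩
  have hd1 : 1 ≤ d := by rw [hd]; exact Int.natAbs_pos.mpr hj
  obtain ⟨k₀, hk₀⟩ : ∃ k₀ : ℕ, k₀ = ⌈2 * 10 ^ 6 * (d : ℝ) * (1 + Real.log d)⌉₊ := ⟨_, rfl⟩
  have hk₀' : 2 * 10 ^ 6 * (d : ℝ) * (1 + Real.log d) ≤ k₀ := by rw [hk₀]; exact Nat.le_ceil _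
  obtain ⟨K, hK⟩ : ∃ K : ℕ, K = m * (e - 1) + e * m * k₀ := ⟨_, rfl⟩
  refine ⟨K, fun g hg hflat => ?_⟩
  -- `Θ = (2π)^{j/e} > 0`, `Θ^e = (2π)^{±d}`
  have h2π : (0 : ℝ) < 2 * π := by positivity
  have he' : (e : ℝ) ≠ 0 := by exact_mod_cast he.ne'
  set Θ : ℝ := (2 * π) ^ ((j : ℝ) / (e : ℝ)) with hΘdef
  have hΘ : 0 < Θ := Real.rpow_pos_of_pos h2π _
  have hΘe : Θ ^ e = (2 * π) ^ d ∨ Θ ^ e * (2 * π) ^ d = 1 := by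
    have h1 : Θ ^ e = (2 * π) ^ (j : ℝ) := by
      rw [← Real.rpow_natCast Θ e, hΘdef, ← Real.rpow_mul h2π.le, div_mul_cancel₀ _ he']
    have hj' := Int.natAbs_eq j
    rw [← hd] at hj'
    rcases hj' with hj' | hj'
    · left
      rw [h1, hj', Int.cast_natCast, Real.rpow_natCast]
    · right
      rw [h1, hj', Int.cast_neg, Int.cast_natCast, Real.rpow_neg h2π.le, Real.rpow_natCast,
        inv_mul_cancel₀ (pow_ne_zero _ h2π.ne')]
  -- clearing denominators: `N q = a`, `N q₀ = c`
  obtain ⟨a, ha_def⟩ : ∃ a : ℤ, a = q.num * q₀.den := ⟨_, rfl⟩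
  obtain ⟨N, hN_def⟩ : ∃ N : ℕ, N = q.den * q₀.den := ⟨_, rfl⟩
  obtain ⟨c, hc_def⟩ : ∃ c : ℤ, c = q₀.num * q.den := ⟨_, rfl⟩
  have ha : a ≠ 0 :=
    ha_def ▸ mul_ne_zero (Rat.num_ne_zero.mpr hq) (by exact_mod_cast q₀.den_nz)
  have hNq : (N : ℂ) * (q : ℂ) = (a : ℂ) := by
    have h : (N : ℚ) * q = (a : ℚ) := by
      rw [hN_def, ha_def]; push_cast; linear_combination (q₀.den : ℚ) * Rat.den_mul_eq_num q
    exact_mod_cast h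
  have hNq₀ : (N : ℂ) * (q₀ : ℂ) = (c : ℂ) := by
    have h : (N : ℚ) * q₀ = (c : ℚ) := by
      rw [hN_def, hc_def]; push_cast; linear_combination (q.den : ℚ) * Rat.den_mul_eq_num q₀
    exact_mod_cast h
  -- Taylor: `g z = z^(K+1) F z`, `‖F z‖ ≤ ‖F 0‖ + 1` for `‖z‖ < r₀`
  obtain ⟨F, hF, hgF⟩ := hg.exists_eq_sum_add_pow_mul (K + 1)
  have hgF' : ∀ z, g z = z ^ (K + 1) * F z := fun z => by
    rw [hgF z, Finset.sum_eq_zero fun i hi => ?_, zero_add, smul_eq_mul]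
    rw [hflat i (by rw [Finset.mem_range] at hi; omega), smul_zero]
  obtain ⟨r₀, hr₀, hFb⟩ : ∃ r₀ > 0, ∀ z : ℂ, ‖z‖ < r₀ → ‖F z‖ ≤ ‖F 0‖ + 1 := by
    have hFt : Tendsto (fun z => ‖F z‖) (𝓝 0) (𝓝 ‖F 0‖) := hF.continuousAt.norm
    obtain ⟨r₀, hr₀, h'⟩ :=
      Metric.eventually_nhds_iff.mp (hFt.eventually (eventually_le_nhds (lt_add_one _)))
    exact ⟨r₀, hr₀, fun z hz => h' (by rwa [dist_zero_right])⟩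
  obtain ⟨B, hB_def⟩ : ∃ B : ℝ, B = (N : ℝ) * (‖F 0‖ + 1) := ⟨_, rfl⟩
  have hB0 : 0 ≤ B := by rw [hB_def]; positivity
  -- the per-hit bound `w ≤ R`
  obtain ⟨R, hR⟩ := wildPi_hit_bound (m := m) he hd1 hk₀' hK ha hΘ hΘe hB0
  /- KEY: no late hits -/
  have key : ∀ᶠ n : ℕ in atTop, ∀ L : ℤ,
      (q : ℂ) * ((Θ : ℝ) : ℂ) * rayAbscissa e n ^ m + (q₀ : ℂ) + g (rayAbscissa e n)⁻¹ ≠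
        (L : ℂ) := by
    filter_upwards [eventually_ge_atTop 1,
      (tendsto_natCast_atTop_atTop (R := ℝ)).eventually_gt_atTop (r₀⁻¹ ^ e),
      (tendsto_natCast_atTop_atTop (R := ℝ)).eventually_gt_atTop (R ^ e)] with n hn1 hnr hnR
    intro L hL
    -- the abscissa `w = n^{1/e}`: `w ≥ 1`, `w^e = n`
    have hn1' : (1 : ℝ) ≤ n := by exact_mod_cast hn1
    set w : ℝ := (n : ℝ) ^ ((e : ℝ)⁻¹) with hw_def
    have hwray : rayAbscissa e n = ((w : ℝ) : ℂ) := rfl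
    have hw1 : 1 ≤ w := Real.one_le_rpow hn1' (by positivity)
    have hw0 : 0 < w := by linarith
    have hwe : w ^ e = n := hw_def ▸ Real.rpow_inv_natCast_pow (Nat.cast_nonneg _) he.ne'
    rw [hwray] at hL
    -- `‖σ‖ = w⁻¹ < r₀` and the flat-tail bound `‖g σ‖ ≤ (‖F 0‖ + 1) w^{-(K+1)}`
    have hσ : ‖((w : ℂ))⁻¹‖ < r₀ := by
      rw [norm_inv, Complex.norm_real, Real.norm_eq_abs, abs_of_pos hw0]
      exact inv_lt_of_inv_lt₀ hr₀ (lt_of_pow_lt_pow_left₀ e hw0.le (by rw [hwe]; exact hnr))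
    have hgσ : ‖g ((w : ℂ))⁻¹‖ ≤ (‖F 0‖ + 1) * (w ^ (K + 1))⁻¹ := by
      rw [hgF', norm_mul, norm_pow, norm_inv, Complex.norm_real, Real.norm_eq_abs, abs_of_pos hw0,
        inv_pow, mul_comm]
      exact mul_le_mul_of_nonneg_right (hFb _ hσ) (by positivity)
    -- the hit data `a Θ w^m = Z + ε`, `ε = -N g σ`
    obtain ⟨Z, hZ⟩ : ∃ Z : ℤ, Z = (N : ℤ) * L - c := ⟨_, rfl⟩
    obtain ⟨ε, hε⟩ : ∃ ε : ℝ, ε = (a : ℝ) * Θ * w ^ m - Z := ⟨_, rfl⟩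
    have hεC : (ε : ℂ) = -(N : ℂ) * g ((w : ℂ))⁻¹ := by
      rw [hε, hZ]
      push_cast
      linear_combination (N : ℂ) * hL - ((Θ : ℂ) * (w : ℂ) ^ m) * hNq - hNq₀
    have hεB : |ε| ≤ B * (w ^ (K + 1))⁻¹ := by
      rw [← Real.norm_eq_abs, ← Complex.norm_real, hεC, norm_mul, norm_neg, Complex.norm_natCast,
        hB_def, mul_assoc]
      exact mul_le_mul_of_nonneg_left hgσ (Nat.cast_nonneg _)
    have hεB' : |ε| ≤ B :=
      hεB.trans (mul_le_of_le_one_right hB0 (inv_le_one_of_one_le₀ (one_le_pow₀ hw1)))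
    have hεw : |ε| * w ^ (K + 1) ≤ B := by
      rwa [← div_eq_mul_inv, le_div_iff₀ (by positivity)] at hεB
    have hX : (a : ℝ) * Θ * w ^ m = Z + ε := by rw [hε]; ring
    -- the per-hit bound and the contradiction `n = w^e ≤ R^e < n`
    have hwR : w ≤ R := hR n w Z ε hn1 hw1 hwe hX hεB' hεw
    have hle : (n : ℝ) ≤ R ^ e := by rw [← hwe]; exact pow_le_pow_left₀ hw0.le hwR e
    linarith
  obtain ⟨N₀, hN₀⟩ := eventually_atTop.mp key
  refine (Set.finite_lt_nat N₀).subset ?_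
  rintro n ⟨L, hL⟩
  by_contra h
  exact hN₀ n (not_lt.mp h) L hL

end Summit.Schanuel.Schanuel.Cruxes.SparsityTwo.CuspGermSchneiderSparsity
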